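import Summits.BirchSwinnertonDyer.BirchSwinnertonDyer.Theorems.ResidualThetaTransportAtTwoCmLambdaLowerOfCorank
import Summits.BirchSwinnertonDyer.BirchSwinnertonDyer.Theses.ResidualThetaTransportAtTwo
import HarnessLib

/-!
# Sketch — stub-ideation `stub_cmLambdaLower` k = 1 (gen 2), technique «weaken / strengthen»

Crux (R≥)ᵖ `ResidualThetaCountLowerPureAtTwo` (stmt-BirchSwinnertonDyer-26074), skeleton «bt26-lambda»
(`Cruxes/ResidualThetaCountLowerPureAtTwo/Lines/bt26_lambda.lean` v6), stub S2 `stub_cmLambdaLower :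
Theses.ResidualThetaTransportAtTwo.ResidualSignedLambdaLowerCMAtTwo` (= item RSL_g, stmt-22608, BY NAME).
Helper lemmas for the idea card `Ideas/stub_cmLambdaLower-k1.md` (gen 2).  NOTHING here proves S2, the crux,
or BSD; the sorried declarations are SIGNATURES (helper shapes for the critic / the stub prover), the others are
kernel-checked plumbing.

* §A  `cmLambdaLower_of_corank_of_finite` — the FINITE-BRANCH form of the landed reduction
  `LambdaLowerBoundO.cmLambdaLower_of_corank` (w2): the corank datum (f) is demanded only when `𝒮[ϖ]` is finite
  (the infinite branch of the `Set.encard` inequality is free).  PROVED.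
* §B  `injective_of_dep_of_apply_ne_zero`, `dep_of_rank_le_one`, `comap_eq_bot_of_le_ker` — the abstract
  «rank-one kernel lemma»: the Poitou–Tate obstruction to SURJ⁺ / four-term exactness for `A_g` over `ℚ_∞` is
  `loc₂⁻¹(ann E⁺) ∩ 𝐇¹_Σ(T_g) ⊆ ker(Col⁻ ∘ loc₂ | 𝐇¹_Σ)`, which is `⊥` as soon as `𝐇¹_Σ` is torsion free of rank 1
  (`Kato2004.thm12_4_newform`, typed for every `p`) and `Col⁻(loc₂ z_g) ≠ 0` (ERL + `L⁻_g ≠ 0`).  PROVED.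
* §C  `normLambda_unit_mul` (signature), `normLambda_of_unit_congr` (signature) — ERL is needed only up to
  per-level units: unit-twisted `ω_n`-congruences at infinitely many levels already pin `(λ, μ)`.
-/

set_option autoImplicit false
set_option linter.dupNamespace false
set_option maxHeartbeats 800000

noncomputable section

open scoped Classical

namespace Summit.BirchSwinnertonDyer.BirchSwinnertonDyer.Cruxes.ResidualThetaCountLowerPureAtTwo.StubIdeasK1G2

/-! ### §A. Plan 1 — the finite branch is the only branch (weakest sufficient form of (f)) -/

section PlanA

open Literature.NumberTheory.EllipticCurves Literature.NumberTheory.EllipticCurves.GreenbergSelmer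
open Literature.NumberTheory.GaloisRepresentations NumberField IsDedekindDomain Field
open Summit.BirchSwinnertonDyer.BirchSwinnertonDyer.Theorems.LambdaLowerBoundO (pow_le_encard_of_dualPair_of_subset)
open Literature.NumberTheory.EllipticCurves GreenbergSelmer GreenbergVatsal2000 Kobayashi2003 ModularForms Rank1Residual Literature.NumberTheory.GaloisRepresentations Literature.NumberTheory.Automorphic IsDedekindDomain NumberField Field Rat.HeightOneSpectrum PowerSeries

/-- **H1 (Plan 1). S2 `stub_cmLambdaLower` ⟸ (f) ON THE FINITE BRANCH ONLY.**  Same binders as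
`LambdaLowerBoundO.cmLambdaLower_of_corank` (w2), with ONE extra antecedent in the hypothesis: the corank datum
`(Sg, X, toDual, d + Σ_g(S₀) ≤ rank_𝒪 (X / X_tors))` is required only when the `ϖ`-torsion `𝒮[ϖ]` of the transported
`S₀`-imprimitive plus-Selmer set is FINITE.  On that branch every Pontryagin dual in sight is finitely generated over
`𝒪` (torsion over `Λ_𝒪`, `μ = 0`) for free, so (f) becomes a statement about `Module.finrank` over `𝒪` of honest
finitely generated `𝒪`-modules; on the infinite branch the registered `Set.encard` inequality is `_ ≤ ⊤`.
Conclusion: the route item `ResidualSignedLambdaLowerCMAtTwo` BY NAME (so `exact cmLambdaLower_of_corank_of_finite h`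
closes the stub given `h`).  [cite: EmertonPollackWeston2006, Thm. 3.1.1] [cite: GreenbergLNM1716, §4 p. 98] -/
theorem cmLambdaLower_of_corank_of_finite
    (hcorank : ∀ (W : WeierstrassCurve ℚ) [W.IsElliptic] [W.IsGloballyMinimal], ¬ W.HasCM → W.analyticRank = 0 → GoodSS W 2 → W.frobeniusTrace 2 = 0 → W.Δ < 0 → ∀ (M : ℕ) [NeZero M] (g : CuspForm (CongruenceSubgroup.Gamma0 M) 2) (ι : coeffField g →+* PadicAlgCl 2) (Ω : ℂ), Odd M → IsNewform0 g → IsCMForm (liftToGamma1 M 2 g) → cuspCoeff g 2 = 0 → IsCohomologicalPlusPeriod g ι Ω → (∀ ℓ : ℕ, ℓ.Prime → ¬ ℓ ∣ 2 * M * W.conductorNorm ℤ → ‖embCoeff g ι ℓ - (W.frobeniusTrace ℓ : PadicAlgCl 2)‖ < 1) → ∀ (κ : ZpExtension ℚ 2) (γ : absoluteGaloisGroup ℚ), κ.IsCyclotomic → κ.IsTopGenerator γ → IsCyclotomicVariable 2 γ → ∀ (S₀ : Finset (HeightOneSpectrum (RingOfIntegers ℚ))), (∀ v ∈ S₀, ((2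 : ℕ) : RingOfIntegers ℚ) ∉ v.asIdeal) → (∀ v, ¬ W.HasGoodReductionAt v → v ∈ S₀) → (∀ v, natGenerator v ∣ M → v ∈ S₀) → ∀ (Lp Lm : IwasawaAlgebraO (Set.range ι)) (d : ℕ), IsPollackPairK g ι Ω Lp Lm → (∀ k, ‖coeff k (iwasawaOToPowerSeries (Set.range ι) Lm)‖ ≤ ‖coeff d (iwasawaOToPowerSeries (Set.range ι) Lm)‖) → (∀ k < d, ‖coeff k (iwasawaOToPowerSeries (Set.range ι) Lm)‖ < ‖coeff d (iwasawaOToPowerSeries (Set.range ι) Lm)‖) → ∀ (n : ℕ) (ρ : FramedGaloisRep ℚ ↥(padicCoeffIntegers (Set.range ι)) 2) (Θ : ∀ v : HeightOneSpectrum (RingOfIntegers ℚ), ((2 : ℕ) : RingOfIntegers ℚ) ∈ v.asIdeal → (Cofree ρ ↥(padicCoeffField (Set.range ι)) ≃+ (Fin n → ↥(W.geomPrimaryTorsion 2)))), (∀ v, ¬ natGenerator v ∣ 2 * M → ρ.IsUnramifiedAt v ∧ ∃ P : Polynomial ↥(padicCoeffIntegers (Set.range ι)), P.map (padicCoeffIntegers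 (Set.range ι)).subtype = Polynomial.X ^ 2 - Polynomial.C (embCoeff g ι (natGenerator v)) * Polynomial.X + Polynomial.C ((natGenerator v : ℕ) : PadicAlgCl 2) ∧ ρ.HasFrobCharpolyAt v P) → (∀ v hv (δ : absoluteGaloisGroup (v.adicCompletion ℚ)) m i, Θ v hv (resGalOfEmb (closureEmb (K := ℚ) (v.adicCompletion ℚ)) δ • m) i = resGalOfEmb (closureEmb (K := ℚ) (v.adicCompletion ℚ)) δ • Θ v hv m i) → ∀ (ϖ : ↥(padicCoeffIntegers (Set.range ι))), Irreducible ϖ → {y : subgroupH1 κ.kerSubgroup (Cofree ρ ↥(padicCoeffField (Set.range ι))) | y ∈ unramifiedOutside κ.kerSubgroup (Cofree ρ ↥(padicCoeffField (Set.range ι))) 2 ↑S₀ ∧ (∀ w σ, conjH1 κ.kerSubgroup (Cofree ρ ↥(padicCoeffField (Set.range ι))) σ y ∈ infKer κ.kerSubgroup (Cofree ρ ↥(padicCoeffField (Set.range ι))) w) ∧ (∀ v hv σ, ∃ (φ : _) (Q : Fin n → localPoints W (v.adicCompletion ℚ)) (k : ℕ), oneCocycleClass (discreteTopRep ↥κ.kerSubgroup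 (Cofree ρ ↥(padicCoeffField (Set.range ι)))) φ = conjH1 κ.kerSubgroup (Cofree ρ ↥(padicCoeffField (Set.range ι))) σ y ∧ (∀ i, (2 ^ k) • Q i ∈ ⨆ m : ℕ, signedLocalPoints κ (v.adicCompletion ℚ) W 1 m) ∧ ∀ τ i, pointsMapOfEmb W (closureEmb (K := ℚ) (v.adicCompletion ℚ)) (((Θ v hv (φ.1 (resGalSubgroupOfEmb κ.kerSubgroup (closureEmb (K := ℚ) (v.adicCompletion ℚ)) τ))) i : ↥(W.geomPrimaryTorsion 2)) : W.geomPoints) = (τ : absoluteGaloisGroup (v.adicCompletion ℚ)) • Q i - Q i) ∧ scalarH1 κ.kerSubgroup (Cofree ρ ↥(padicCoeffField (Set.range ι))) ϖ y = 0}.Finite → ∃ (Sg : AddSubgroup (subgroupH1 κ.kerSubgroup (Cofree ρ ↥(padicCoeffField (Set.range ι))))), (↑Sg : Set (subgroupH1 κ.kerSubgroup (Cofree ρ ↥(padicCoeffField (Set.range ι))))) ⊆ {y : subgroupH1 κ.kerSubgroup (Cofree ρ ↥(padicCoeffField (Set.range ι))) | y ∈ unramifiedOutside κ.kerSubgroup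 (Cofree ρ ↥(padicCoeffField (Set.range ι))) 2 ↑S₀ ∧ (∀ w σ, conjH1 κ.kerSubgroup (Cofree ρ ↥(padicCoeffField (Set.range ι))) σ y ∈ infKer κ.kerSubgroup (Cofree ρ ↥(padicCoeffField (Set.range ι))) w) ∧ (∀ v hv σ, ∃ (φ : _) (Q : Fin n → localPoints W (v.adicCompletion ℚ)) (k : ℕ), oneCocycleClass (discreteTopRep ↥κ.kerSubgroup (Cofree ρ ↥(padicCoeffField (Set.range ι)))) φ = conjH1 κ.kerSubgroup (Cofree ρ ↥(padicCoeffField (Set.range ι))) σ y ∧ (∀ i, (2 ^ k) • Q i ∈ ⨆ m : ℕ, signedLocalPoints κ (v.adicCompletion ℚ) W 1 m) ∧ ∀ τ i, pointsMapOfEmb W (closureEmb (K := ℚ) (v.adicCompletion ℚ)) (((Θ v hv (φ.1 (resGalSubgroupOfEmb κ.kerSubgroup (closureEmb (K := ℚ) (v.adicCompletion ℚ)) τ))) i : ↥(W.geomPrimaryTorsion 2)) : W.geomPoints) = (τ : absoluteGaloisGroup (v.adicCompletion ℚ)) • Q i - Q i)} ∧ (∀ (r : ↥(padicCoeffIntegers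 (Set.range ι))) (c : subgroupH1 κ.kerSubgroup (Cofree ρ ↥(padicCoeffField (Set.range ι)))), c ∈ Sg → scalarH1 κ.kerSubgroup (Cofree ρ ↥(padicCoeffField (Set.range ι))) r c ∈ Sg) ∧ ∃ (X : Type) (_ : AddCommGroup X) (_ : Module (IwasawaAlgebraO (Set.range ι)) X) (_ : Module ↥(padicCoeffIntegers (Set.range ι)) X) (_ : IsScalarTower ↥(padicCoeffIntegers (Set.range ι)) (IwasawaAlgebraO (Set.range ι)) X) (_ : Module.Finite (IwasawaAlgebraO (Set.range ι)) X) (toDual : X →+ (↥Sg →+ AddCircle (1 : ℚ))), Function.Bijective toDual ∧ (∀ (a : ↥(padicCoeffIntegers (Set.range ι))) (x : X) (s : ↥Sg) (hs : scalarH1 κ.kerSubgroup (Cofree ρ ↥(padicCoeffField (Set.range ι))) a (s : subgroupH1 κ.kerSubgroup (Cofree ρ ↥(padicCoeffField (Set.range ι)))) ∈ Sg), toDual ((PowerSeries.C a : IwasawaAlgebraO (Set.range ι)) • x) s = toDual x ⟨scalarH1 κ.kerSubgroup (Cofree ρ ↥(padicCoeffField (Set.range ι))) a (s : subgroupH1 κ.kerSubgroup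 (Cofree ρ ↥(padicCoeffField (Set.range ι)))), hs⟩) ∧ (d + ∑ v ∈ S₀, 2 ^ padicValNat 2 ((natGenerator v ^ 2 - 1) / 8) * (if natGenerator v ∣ M then (if ‖embCoeff g ι (natGenerator v) - 1‖ < 1 then 1 else 0) else (if ‖embCoeff g ι (natGenerator v)‖ < 1 then 2 else 0))) ≤ Module.finrank ↥(padicCoeffIntegers (Set.range ι)) (X ⧸ Submodule.torsion ↥(padicCoeffIntegers (Set.range ι)) X)) :
    Summit.BirchSwinnertonDyer.BirchSwinnertonDyer.Theses.ResidualThetaTransportAtTwo.ResidualSignedLambdaLowerCMAtTwo := by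
  intro W _ _ hCM hr0 hss ha2 hΔ M _ g ι Ω hM hnew hcmf ha2g hΩ hcong κ γ hκ hγ hcyc S₀ hS₀ hbad hMS Lp Lm d hpair
    hle hlt n ρ Θ hρ hΘ ϖ hϖ
  by_cases hfin : ({y : subgroupH1 κ.kerSubgroup (Cofree ρ ↥(padicCoeffField (Set.range ι))) | y ∈ unramifiedOutside κ.kerSubgroup (Cofree ρ ↥(padicCoeffField (Set.range ι))) 2 ↑S₀ ∧ (∀ w σ, conjH1 κ.kerSubgroup (Cofree ρ ↥(padicCoeffField (Set.range ι))) σ y ∈ infKer κ.kerSubgroup (Cofree ρ ↥(padicCoeffField (Set.range ι))) w) ∧ (∀ v hv σ, ∃ (φ : _) (Q : Fin n → localPoints W (v.adicCompletion ℚ)) (k : ℕ), oneCocycleClass (discreteTopRep ↥κ.kerSubgroup (Cofree ρ ↥(padicCoeffField (Set.range ι)))) φ = conjH1 κ.kerSubgroup (Cofree ρ ↥(padicCoeffField (Set.range ι))) σ y ∧ (∀ i, (2 ^ k) • Q i ∈ ⨆ m : ℕ, signedLocalPoints κ (v.adicCompletion ℚ) W 1 m) ∧ ∀ τ i, pointsMapOfEmb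 W (closureEmb (K := ℚ) (v.adicCompletion ℚ)) (((Θ v hv (φ.1 (resGalSubgroupOfEmb κ.kerSubgroup (closureEmb (K := ℚ) (v.adicCompletion ℚ)) τ))) i : ↥(W.geomPrimaryTorsion 2)) : W.geomPoints) = (τ : absoluteGaloisGroup (v.adicCompletion ℚ)) • Q i - Q i) ∧ scalarH1 κ.kerSubgroup (Cofree ρ ↥(padicCoeffField (Set.range ι))) ϖ y = 0} : Set _).Finite
  · obtain ⟨Sg, hSg𝒮, hscal, X, iX, iΛ, i𝒪, iT, iF, toDual, hbij, hC, hrank⟩ :=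
      hcorank W hCM hr0 hss ha2 hΔ M g ι Ω hM hnew hcmf ha2g hΩ hcong κ γ hκ hγ hcyc S₀ hS₀ hbad hMS Lp Lm d hpair
        hle hlt n ρ Θ hρ hΘ ϖ hϖ hfin
    haveI : FiniteDimensional ℚ (ModularForms.coeffField g) :=
      ModularForms.IsNewform0.finiteDimensional_coeffField_holds hnew
    haveI : FiniteDimensional ℚ_[2] ↥(padicCoeffField (Set.range ι)) :=
      GreenbergSelmer.finiteDimensional_padicCoeffField ι
    have key := pow_le_encard_of_dualPair_of_subset (Set.range ι) κ ρ Sg (fun r _ hc ↦ hscal r _ hc) _ hSg𝒮 X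
      toDual hbij (fun a x s ↦ hC a x s (hscal a _ s.2)) ϖ hϖ _ hrank
    refine le_of_le_of_eq key (congrArg Set.encard (Set.ext fun y ↦ ?_))
    constructor
    · rintro ⟨⟨h1, h2, h3⟩, h4⟩
      exact ⟨h1, h2, h3, h4⟩
    · rintro ⟨h1, h2, h3, h4⟩
      exact ⟨⟨h1, h2, h3⟩, h4⟩
  · rw [Set.Infinite.encard_eq hfin]
    exact le_top

end PlanA

/-! ### §B. Plan 2 — the global-duality input at its weakest: a rank-one kernel lemma -/

section PlanB

variable {R : Type*} [CommRing R] {M N P : Type*} [AddCommGroup M] [Module R M] [AddCommGroup N] [Module R N]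
  [AddCommGroup P] [Module R P]

/-- **H2 (Plan 2). Rank-`≤ 1` source, torsion-free target, one non-vanishing value ⇒ injective.**  Abstract
form of «`𝐇¹_Σ(T_g)` torsion free of `Λ_𝒪`-rank 1 (Kato 12.4 (2)) and `Col⁻(loc₂ z_g) ≠ 0` (ERL, `L⁻_g ≠ 0`) ⇒
`Col⁻ ∘ loc₂` is injective on `𝐇¹_Σ(T_g)`».  `hdep` is «any two elements are linearly dependent» (rank `≤ 1`,
see `dep_of_rank_le_one`). [cite: Kobayashi2003, Thm. 7.3 (proof)] [cite: Kato2004Asterisque, Thm. 12.4 (2)] -/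
theorem injective_of_dep_of_apply_ne_zero [IsDomain R] [Module.IsTorsionFree R M] [Module.IsTorsionFree R N]
    (f : M →ₗ[R] N)
    (hdep : ∀ m z : M, ∃ a b : R, (a ≠ 0 ∨ b ≠ 0) ∧ a • m = b • z) {z : M} (hz : f z ≠ 0) :
    Function.Injective f := by
  rw [← LinearMap.ker_eq_bot, Submodule.eq_bot_iff]
  intro m hm
  rw [LinearMap.mem_ker] at hm
  obtain ⟨a, b, hab, h⟩ := hdep m z
  have hbz : b • f z = 0 := by rw [← map_smul, ← h, map_smul, hm, smul_zero]
  rcases hab with ha | hb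
  · have hb : b = 0 := (smul_eq_zero.mp hbz).resolve_right hz
    rw [hb, zero_smul] at h
    exact (smul_eq_zero.mp h).resolve_left ha
  · exact absurd ((smul_eq_zero.mp hbz).resolve_left hb) hz

/-- **H2′ (Plan 2). Rank `≤ 1` ⇒ any two elements are linearly dependent** — the bridge from the binder
`Module.rank Λ_𝒪 I.H = 1` of `Kato2004.thm12_4_newform` to `hdep` of H2. [cite: Kato2004Asterisque, Thm. 12.4 (2)] -/
theorem dep_of_rank_le_one [Nontrivial R] (h : Module.rank R M ≤ 1) (m z : M) :
    ∃ a b : R, (a ≠ 0 ∨ b ≠ 0) ∧ a • m = b • z := by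
  by_contra hcon
  push Not at hcon
  have hli : LinearIndependent R ![m, z] := by
    rw [LinearIndependent.pair_iff]
    intro s t hst
    by_contra hst'
    have hs : s ≠ 0 ∨ -t ≠ 0 := by
      by_cases h0 : s = 0
      · exact Or.inr (by rw [ne_eq, neg_eq_zero]; exact fun ht ↦ hst' ⟨h0, ht⟩)
      · exact Or.inl h0
    apply hcon s (-t) hs
    rw [neg_smul, eq_neg_iff_add_eq_zero, hst]
  have h2 := hli.cardinal_lift_le_rank
  rw [Cardinal.mk_fin, Cardinal.lift_natCast] at h2
  have h1 : Cardinal.lift.{0} (Module.rank R M) ≤ Cardinal.lift.{0} (1 : Cardinal) := Cardinal.lift_le.mpr h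
  rw [Cardinal.lift_one] at h1
  have h21 := h2.trans h1
  have : Nat.succ (Nat.succ 0) ≤ 1 := by exact_mod_cast h21
  omega

/-- **H3 (Plan 2). The Poitou–Tate obstruction module is `⊥`.**  Abstractly: `M = 𝐇¹_Σ(T_g)` (global Iwasawa
cohomology), `P = H¹_Iw(ℚ_{∞,2}, T_g)`, `loc : M → P`, `Ann ⊆ P` the annihilator of the plus condition
`E⁺(ℚ_{∞,2}) ⊗ F/𝒪`, `Col : P → Λ_𝒪` the minus Coleman map with `Ann ≤ ker Col` (the pairing-trivial inclusion,
k4-H3); the obstruction to surjectivity / middle-exactness in the plus four-term sequence for `A_g` over `ℚ_∞` is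
`loc⁻¹(Ann)`, and it vanishes by H2.  NO weak Leopoldt, NO `X⁺(g)` cotorsion, NO corank calculus for `A_g`.
[cite: Kobayashi2003, Thm. 7.3] [cite: GreenbergVatsal2000, Prop. 2.1] -/
theorem comap_eq_bot_of_le_ker [IsDomain R] [Module.IsTorsionFree R M] [Module.IsTorsionFree R N]
    (loc : M →ₗ[R] P)
    (Ann : Submodule R P) (Col : P →ₗ[R] N) (hAnn : Ann ≤ LinearMap.ker Col)
    (hdep : ∀ m z : M, ∃ a b : R, (a ≠ 0 ∨ b ≠ 0) ∧ a • m = b • z) {z : M} (hz : Col (loc z) ≠ 0) :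
    Ann.comap loc = ⊥ := by
  have hinj : Function.Injective (Col.comp loc) :=
    injective_of_dep_of_apply_ne_zero (Col.comp loc) hdep (z := z) (by simpa using hz)
  rw [Submodule.eq_bot_iff]
  intro m hm
  have h0 : Col (loc m) = 0 := LinearMap.mem_ker.mp (hAnn (Submodule.mem_comap.mp hm))
  exact hinj (by rw [LinearMap.comp_apply, h0, map_zero])


/-- **H3b (Plan 2). The Σ-native λ-bookkeeping is an IDENTITY, and S2's inequality is exactly the one-sided
Σ-imprimitive Kato/BT26 defect.**  Integers: `xPlus = λ(X⁺_{S₀})`, `colQuot = λ(Λ_𝒪/Col⁺(loc₂(E·z)))`,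
`h1str = λ(𝐇¹_str/Λ·E·z)`, `x0rel = λ(X₀^{S₀-rel})`, `xstr = λ(X_{str,Σ})`, `delta = λ(𝐇¹_Σ/𝐇¹_str)`,
`h2 = λ(𝐇²_Σ)`, `h1 = λ(𝐇¹_Σ/Λ·E·z)`, `sigma = Σ_g(S₀) = Σ_v λ(H¹_Iw(ℚ_v,T_g)) = Σ_v λ(H²_Iw(ℚ_v,T_g))`.
(e1) four-term sequence (FT_Σ) + additivity; (e2) ERL-abs + `λ(E_v(γ_v))` (landed Euler-factor finranks);
(e3) image = annihilator for the pair (str_Σ ≤ (0 at 2, all at S₀)); (e4) compact PT five-term at Σ with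
`A_g(ℚ_∞)[ϖ] = 0`; (e5) `𝐇¹_str ⊆ 𝐇¹_Σ ∋ E·z`.  Conclusion: `xPlus = d + sigma + (h2 − h1)`, so
`d + sigma ≤ xPlus ↔ h1 ≤ h2`. [cite: Kato2004Asterisque, Thm. 12.4–12.5, Conj. 12.10 (S-imprimitive 𝐇ⁱ)]
[cite: GreenbergVatsal2000, §2 (Prop. 2.1, Cor. 2.3, Prop. 2.4)] -/
theorem lambdaBookkeeping_sigma (xPlus colQuot h1str x0rel xstr delta h2 h1 d sigma : ℤ)
    (e1 : xPlus = colQuot - h1str + x0rel) (e2 : colQuot = d + sigma) (e3 : x0rel = xstr + sigma - delta)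
    (e4 : xstr = h2 - sigma) (e5 : h1str + delta = h1) :
    xPlus = d + sigma + (h2 - h1) ∧ (d + sigma ≤ xPlus ↔ h1 ≤ h2) := by
  constructor <;> omega

variable {Λ Q : Type*} [CommRing Λ] [AddCommGroup Q] [Module Λ Q]

/-- **H3c (Plan 2, signature). Cayley–Hamilton kill: `det(φ − 1)` annihilates `coker(φ − 1)`.**  With
`Q = T^{I_v} ⊗ Λ_v` (free of rank `≤ 2`), `φ = Frob_v ⊗ γ_v⁻¹`: the unramified local Iwasawa cohomology
`H¹_{ur,Iw}(ℚ_v, T_g) ≅ coker(φ − 1)` is killed by the Euler factor `E_v = det(φ − 1) ∈ Λ_𝒪`, so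
`E·z_g ∈ 𝐇¹_str` for `E = ∏_{v ∈ S₀} E_v` — the S₀-imprimitive zeta element lies in the strict-at-S₀ Iwasawa
cohomology.  Proof route: adjugate identity (`Matrix.mul_adjugate`).  [cite: GreenbergVatsal2000, Prop. 2.4]
[cite: Kato2004Asterisque, §13.? (S-imprimitive zeta elements `z^{(S)}`)] -/
theorem det_smul_mem_range [Module.Free Λ Q] [Module.Finite Λ Q] (f : Q →ₗ[Λ] Q) (x : Q) :
    LinearMap.det f • x ∈ LinearMap.range f := by
  classical
  haveI : Fintype (Module.Free.ChooseBasisIndex Λ Q) := Module.Free.ChooseBasisIndex.fintype Λ Q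
  let b := Module.Free.chooseBasis Λ Q
  set A := LinearMap.toMatrix b b f with hA
  refine ⟨b.equivFun.symm (A.adjugate.mulVec (b.equivFun x)), ?_⟩
  apply b.equivFun.injective
  have hrepr : ∀ y : Q, b.equivFun (f y) = A.mulVec (b.equivFun y) := by
    intro y
    have := LinearMap.toMatrix_mulVec_repr b b f y
    simpa [Module.Basis.equivFun_apply, hA] using this.symm
  rw [hrepr, LinearEquiv.apply_symm_apply, Matrix.mulVec_mulVec, Matrix.mul_adjugate,
    Matrix.smul_mulVec, Matrix.one_mulVec, map_smul, hA, LinearMap.det_toMatrix]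

end PlanB

/-! ### §C. Plan 3 — ERL is needed only up to per-level units (weakest analytic input) -/

section PlanC

open PowerSeries Polynomial Literature.NumberTheory.EllipticCurves

variable {p : ℕ} [Fact p.Prime] (S : Set (PadicAlgCl p))

/-- **H4a (Plan 3, signature). `normLambda` is invariant under units of `𝒪⟦T⟧`.**  If `G ∈ 𝒪⟦T⟧` has its
`d`-th coefficient of maximal norm, strictly dominating the lower ones (the two LITERAL binders of the stub for
`Lm`), then so does `u·G` for every unit `u` (ultrametric inequality; `‖u₀‖ = 1`).  Routine; not proved here.
[cite: Washington1997, §7.1 (Weierstrass preparation, λ and μ of a product)] -/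
theorem normLambda_unit_mul (u : (IwasawaAlgebraO S)ˣ) (G : IwasawaAlgebraO S) (d : ℕ)
    (hle : ∀ k, ‖coeff k (iwasawaOToPowerSeries S G)‖ ≤ ‖coeff d (iwasawaOToPowerSeries S G)‖)
    (hlt : ∀ k < d, ‖coeff k (iwasawaOToPowerSeries S G)‖ < ‖coeff d (iwasawaOToPowerSeries S G)‖) :
    (∀ k, ‖coeff k (iwasawaOToPowerSeries S ((u : IwasawaAlgebraO S) * G))‖ ≤
        ‖coeff d (iwasawaOToPowerSeries S ((u : IwasawaAlgebraO S) * G))‖) ∧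
      ∀ k < d, ‖coeff k (iwasawaOToPowerSeries S ((u : IwasawaAlgebraO S) * G))‖ <
        ‖coeff d (iwasawaOToPowerSeries S ((u : IwasawaAlgebraO S) * G))‖ := by
  sorry

/-- **H4 (Plan 3, signature). Unit-twisted `ω_n`-congruences at infinitely many levels transfer `normLambda`.**
If `F ≡ u_n · G (mod ω_n)` in `𝒪⟦T⟧` for infinitely many `n`, with `u_n ∈ 𝒪⟦T⟧ˣ` ALLOWED TO DEPEND ON `n`
(no compatibility asked), then `F` has the same `normLambda` index `d` as `G` (hence the same `λ = d` and the same
`μ`).  Route of proof: `G` has finitely many zeros `ζ - 1` (Weierstrass), so for `n ≥ n₁` it is coprime to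
`ν_n = ω_n/ω_{n₁}`; two congruences give `ν_n ∣ (u_n − u_{n'})·G`, hence `u_n ≡ u_{n'} (mod ν_n)` (UFD `𝒪⟦T⟧`);
`u := lim u_n ∈ 𝒪⟦T⟧ˣ` and `F = u·G`; conclude by H4a.  (Alternative: `‖F(ζ-1)‖ = ‖G(ζ-1)‖` at all `ζ` of large
`2`-power order and the asymptotics `v(F(ζ_{2^k} − 1)) = μ + λ/2^{k-1}`.)  The single-level version is FALSE when
`μ(G) > 0` (`F = G + ω_n` has `μ = 0`). [cite: Washington1997, §7.2 (Iwasawa's theorem: asymptotics of `F(ζ − 1)`)]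
[cite: Pollack2003, Thm. 6.17–Prop. 6.18 (congruences mod `ω_n`)] -/
theorem normLambda_of_unit_congr (F G : IwasawaAlgebraO S) (d : ℕ)
    (hle : ∀ k, ‖coeff k (iwasawaOToPowerSeries S G)‖ ≤ ‖coeff d (iwasawaOToPowerSeries S G)‖)
    (hlt : ∀ k < d, ‖coeff k (iwasawaOToPowerSeries S G)‖ < ‖coeff d (iwasawaOToPowerSeries S G)‖)
    (h : ∀ n₀ : ℕ, ∃ n, n₀ ≤ n ∧ ∃ (u : (IwasawaAlgebraO S)ˣ) (q : IwasawaAlgebraO S),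
      F - (u : IwasawaAlgebraO S) * G =
        (((cyclotomicOmega p n).map (Int.castRingHom (padicCoeffIntegers S)) : (padicCoeffIntegers S)[X]) :
            IwasawaAlgebraO S) * q) :
    (∀ k, ‖coeff k (iwasawaOToPowerSeries S F)‖ ≤ ‖coeff d (iwasawaOToPowerSeries S F)‖) ∧
      ∀ k < d, ‖coeff k (iwasawaOToPowerSeries S F)‖ < ‖coeff d (iwasawaOToPowerSeries S F)‖ := by
  sorry

end PlanC

end Summit.BirchSwinnertonDyer.BirchSwinnertonDyer.Cruxes.ResidualThetaCountLowerPureAtTwo.StubIdeasK1G2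

end
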